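import Summits.CriticalPhenomena.PercolationContinuityZ3.Theorems.Transplant.FKConnectivityAllQTwoSumParts
import Summits.CriticalPhenomena.PercolationContinuityZ3.Theorems.Transplant.FKConnectivityAllQK5Supp
import HarnessLib

/-!
# Connectivity correlation inequalities for `φ_{w,q}`, every `q > 0` — negative correlation of ONE pair of pairs is preserved when
# an edge elsewhere is replaced by an arbitrary two-terminal graph (the per-pair form of the pure case of Wagner's two-sum theorem)

Helper file (`--supports stmt-CriticalPhenomena-4575`), FK sub-lane `prim-bschramm-fk-3` (gen 10) of the post-continuity programme;
builds on p205010 (kernel theorem, internal audit signed; external expert review pending).  No definitions, no named facts, no sorries;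
standard axioms.

fk-1 g6's `negCorr_twoSum_pure` (`…TwoSumParts`): in a two-sum / parallel connection `E₁ ∪ E₂` along the virtual pair `st`
(`E₁, E₂` disjoint on vertex sets meeting inside `{s, t}`), the second part acts on the events of the first part as ONE EFFECTIVE EDGE
`st` with a parameter in `[0,1]` (`twoSum_effective_edge`, exact for every `q > 0`).  Its proof uses negative association of the first
part only through the ONE pair `(e, f)` under study; here this is recorded as the per-pair statement
**`NegCorrPairSupp.twoSum_pure`**: `NegCorrPairSupp (insert st E₁) q e f → NegCorrPairSupp (E₁ ∪ E₂) q e f` for `e, f ∈ E₁`.  So the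
supports on which a given adjacent pair is negatively correlated are closed under replacing any OTHER edge by an arbitrary finite
two-terminal graph (subdivision, parallel paths, any gadget); with the `K₅` certificate (gen 10, `negCorrPairSupp_of_verts_card_le_five`):
**`negCorrPairSupp_twoSum_core_le_five`** — if `E₁ ∪ {st}` spans at most five vertices containing `x, y, z`, then `(xy, xz)` is
negatively correlated under every `φ_{w,q}`, `0 < q ≤ 1`, supported in `E₁ ∪ E₂`, whatever the second part `E₂` glued at `s, t` is
(e.g. every subdivision of one edge of `K₅`, or `K₅` with an edge replaced by any two-terminal network).
[cite: Wagner2006, Lemma 5.5(d), Thm. 5.8(d) (pp. 14–15)] [cite: Grimmett2006, Thm. (3.1)(a) (p. 37); §3.9 eq. (3.94) (pp. 63–64)]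
-/

noncomputable section

namespace Summit.CriticalPhenomena.PercolationContinuityZ3.Theorems

namespace FK

open MeasureTheory Literature.Probability.LatticeModels Literature.Probability.Percolation
open Literature.Probability.Percolation.DecisionTree (ind ind_of_mem ind_of_not_mem ind_nonneg)
open scoped Classical symmDiff

variable {V : Type*} [Fintype V] {E₁ E₂ : Set (Sym2 V)} {V₁ V₂ : Set V}

/-- **Per-pair two-sum, pure case** (`0 < q`, `st ∉ E₁`, `e, f ∈ E₁`): if `(e, f)` is negatively correlated under every `φ_{u,q}`
supported in `insert st E₁`, then under every `φ_{w,q}` supported in `E₁ ∪ E₂` — the second part is an effective edge `st`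
(fk-1 g6's `twoSum_effective_edge`; this is `negCorr_twoSum_pure` with its hypothesis restricted to the one pair it uses).
[cite: Wagner2006, Thm. 5.8(d), proof, second case (pp. 14–15)] [cite: Grimmett2006, §3.9 eq. (3.94) (p. 63)] -/
theorem NegCorrPairSupp.twoSum_pure {q : ℝ} (hq0 : 0 < q) (hd : Disjoint E₁ E₂) (h₁ : ∀ e ∈ E₁, ∀ z ∈ e, z ∈ V₁)
    (h₂ : ∀ e ∈ E₂, ∀ z ∈ e, z ∈ V₂) {s t : V} (hS : V₁ ∩ V₂ ⊆ {s, t}) (hst : s ≠ t) (hst₁ : s(s, t) ∉ E₁) {e f : Sym2 V}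
    (he : e ∈ E₁) (hf : f ∈ E₁) (h : NegCorrPairSupp (insert s(s, t) E₁) q e f) : NegCorrPairSupp (E₁ ∪ E₂) q e f := by
  intro w hw
  obtain ⟨u, c, hc, -, hu, hid⟩ := twoSum_effective_edge w hq0 hd h₁ h₂ hS hst hst₁
  have he₂ : e ∉ E₂ := fun h' => Set.disjoint_left.1 hd he h'
  have hf₂ : f ∉ E₂ := fun h' => Set.disjoint_left.1 hd hf h'
  have hest : e ≠ s(s, t) := fun h' => hst₁ (h' ▸ he)
  have hfst : f ≠ s(s, t) := fun h' => hst₁ (h' ▸ hf)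
  -- the four events are read on the first part and do not depend on `st`
  have locEF : ∀ η₁ η₂ : Set (Sym2 V), η₁ ⊆ E₁ → η₂ ⊆ E₂ →
      (η₁ ∪ η₂ ∈ ({η | e ∈ η} ∩ {η | f ∈ η} : Set (BondConfig V)) ↔ η₁ ∈ ({η | e ∈ η} ∩ {η | f ∈ η} : Set (BondConfig V))) := by
    intro η₁ η₂ g₁ g₂
    rw [Set.mem_inter_iff, Set.mem_inter_iff, markLocal_openPair he₂ η₁ η₂ g₁ g₂, markLocal_openPair hf₂ η₁ η₂ g₁ g₂]
  have insE : ∀ ω : BondConfig V, ω ∆ {s(s, t)} ∈ ({η | e ∈ η} : Set (BondConfig V)) ↔ ω ∈ ({η | e ∈ η} : Set (BondConfig V)) :=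
    fun ω => mem_symmDiff_singleton_of_ne ω hest
  have insF : ∀ ω : BondConfig V, ω ∆ {s(s, t)} ∈ ({η | f ∈ η} : Set (BondConfig V)) ↔ ω ∈ ({η | f ∈ η} : Set (BondConfig V)) :=
    fun ω => mem_symmDiff_singleton_of_ne ω hfst
  have insEF : ∀ ω : BondConfig V, ω ∆ {s(s, t)} ∈ ({η | e ∈ η} ∩ {η | f ∈ η} : Set (BondConfig V)) ↔
      ω ∈ ({η | e ∈ η} ∩ {η | f ∈ η} : Set (BondConfig V)) := by
    intro ω
    rw [Set.mem_inter_iff, Set.mem_inter_iff, insE ω, insF ω]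
  have iEF := hid _ locEF insEF
  have iE := hid _ (markLocal_openPair he₂) insE
  have iF := hid _ (markLocal_openPair hf₂) insF
  have iN := hid Set.univ (markLocal_univ E₁ E₂) (fun ω => by simp)
  -- negative correlation of `(e, f)` for the effective weight vector, in mass form
  have hNC := (negCorr_real_iff_mass hq0 u e f).1 (h u hu)
  have hZu : ∑ ω : BondConfig V, rcWeightW u q ∅ ω * ind (Set.univ : Set (BondConfig V)) ω = rcPartitionFunctionW u q ∅ := by
    unfold rcPartitionFunctionW
    exact Finset.sum_congr rfl fun ω _ => by rw [ind_of_mem (Set.mem_univ _), mul_one]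
  rw [hZu] at iN
  -- transfer to `w`
  rw [negCorr_real_iff_mass hq0]
  have hSw : ∀ A : Set (BondConfig V), ∑ ω : BondConfig V, rcWeightW w q ∅ ω * ind A ω = netMass w q (E₁ ∪ E₂) A :=
    fun A => sum_rcWeightW_ind_eq_netMass w q hw A
  have hZw : rcPartitionFunctionW w q ∅ = netMass w q (E₁ ∪ E₂) Set.univ := by
    rw [← hSw]
    unfold rcPartitionFunctionW
    exact Finset.sum_congr rfl fun ω _ => by rw [ind_of_mem (Set.mem_univ _), mul_one]
  rw [hSw, hSw, hSw, hZw]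
  have hX : 0 < q ^ Fintype.card V := pow_pos hq0 _
  have key : (q ^ Fintype.card V * netMass w q (E₁ ∪ E₂) ({η | e ∈ η} ∩ {η | f ∈ η})) *
      (q ^ Fintype.card V * netMass w q (E₁ ∪ E₂) Set.univ) ≤
      (q ^ Fintype.card V * netMass w q (E₁ ∪ E₂) {η | e ∈ η}) * (q ^ Fintype.card V * netMass w q (E₁ ∪ E₂) {η | f ∈ η}) := by
    rw [iEF, iE, iF, iN]
    nlinarith [mul_le_mul_of_nonneg_left hNC (mul_pos hc hc).le]
  nlinarith [key, mul_pos hX hX]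

/-- **A five-vertex core with one edge replaced by an arbitrary two-terminal graph** (`0 < q ≤ 1`): if `E₁` together with the
virtual pair `st` has all its ends in a set `A` of at most five vertices containing `x, y, z` (`y ≠ z`), `s(x,y), s(x,z) ∈ E₁`,
`st ∉ E₁`, and `E₂` is any part glued at `s, t`, then `(xy, xz)` is negatively correlated under every `φ_{w,q}` supported in `E₁ ∪ E₂`.
(The `K₅` certificate `negCorrPairSupp_of_verts_card_le_five` + the per-pair two-sum.)
[cite: Wagner2006, Thm. 5.8(d) (pp. 14–15)] [cite: Grimmett2006, §3.9 eq. (3.94), Conj. (3.96) (pp. 63–66)] -/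
theorem negCorrPairSupp_twoSum_core_le_five {q : ℝ} (hq0 : 0 < q) (hq1 : q ≤ 1) (hd : Disjoint E₁ E₂)
    (h₁ : ∀ e ∈ E₁, ∀ z ∈ e, z ∈ V₁) (h₂ : ∀ e ∈ E₂, ∀ z ∈ e, z ∈ V₂) {s t : V} (hS : V₁ ∩ V₂ ⊆ {s, t}) (hst : s ≠ t)
    (hst₁ : s(s, t) ∉ E₁) (A : Finset V) (hA : A.card ≤ 5) (hEA : ∀ e ∈ E₁, ∀ v ∈ e, v ∈ A) (hsA : s ∈ A) (htA : t ∈ A)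
    {x y z : V} (hx : x ∈ A) (hy : y ∈ A) (hz : z ∈ A) (hyz : y ≠ z) (hxy : s(x, y) ∈ E₁) (hxz : s(x, z) ∈ E₁) :
    NegCorrPairSupp (E₁ ∪ E₂) q s(x, y) s(x, z) := by
  refine NegCorrPairSupp.twoSum_pure hq0 hd h₁ h₂ hS hst hst₁ hxy hxz ?_
  refine negCorrPairSupp_of_verts_card_le_five hq0 hq1 A hA (fun e he v hv => ?_) hx hy hz hyz
  rcases Set.mem_insert_iff.1 he with rfl | he
  · rcases Sym2.mem_iff.1 hv with rfl | rfl
    · exact hsA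
    · exact htA
  · exact hEA e he v hv

end FK

end Summit.CriticalPhenomena.PercolationContinuityZ3.Theorems

end
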